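import Mathlib
import HarnessLib
import Literature.Analysis.FluidPDE.TypeIAncientMild
import Literature.Analysis.FluidPDE.KochTataruKernel
import Literature.Analysis.FluidPDE.ChaeWolfRemovingDSSBounds
import Literature.Analysis.UnboundedOperators.HeatExtensionDecay

/-!
# Route `PoloidalWindowDoor`, crux `PoloidalWindowRigidity` (stmt-NavierStokesRegularity-19708) — LINE 22 «uniform_return» v1.0
# (ns-idea-8 g11, `Cruxes/PoloidalWindowRigidity/Lines/uniform_return.lean` cecf59ab1752): support stub U1b
# `stub_windowGap : WindowGap`, VERBATIM (the Cruxes-local `WindowGap` unfolded)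

Seat ns-es-p1 g8 (free prover hand on ⟨19708⟩; CLAIM announced on the ideators bus before proposing).

* `windowGap` — **the windowed Kato / Koch–Tataru gap, run FORWARD in geometric time steps.**  For every Type-I
  constant `C` there is `ε₁ = ε₁(C) > 0` (in fact `ε₁ = 1/(32 K M₀ + 1)` depends only on Koch–Tataru's kernel constant
  in dimension three) such that for every element `U` of the Type-I ancient mild class `A_C`
  (`Literature.Analysis.FluidPDE.IsTypeIAncientMild C U`), scale-covariant smallness `√(−t)‖U(t,x)‖ ≤ ε ≤ ε₁` on ONE
  time window `t ∈ [−4T, −T]` propagates to `√(−t)‖U(t,x)‖ ≤ 2ε` on all of `[−4T, 0)`.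

PROOF (Chae–Wolf 2017, proof of Thm 1.3, Step 1, windowed; template: the tree's gap theorem
`SymmetricLiouville.Negative.exists_eps_small_vanishes`).  Write `r = √(−t)`.  The Oseen identity of the class from `4t`
to `t` (`IsTypeIAncientMild.mild_eq_heatExtension`) gives `U(t) = e^{−3tΔ}U(4t) − ∫_{4t}^{t}∫ K(t−σ, x−y)[U(σ,y),U(σ,y)] dy dσ`.
If `√(−s)‖U(s)‖ ≤ 2ε` is known for `s ∈ [−4T, a]` (`−T ≤ a < 0`) and `t ∈ (a, (1−δ)a]`, `δ ≤ ½`, then `4t ≤ a`, the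
caloric term is `≤ 2ε/√(−4t) = ε/r` (sup-norm contraction, `norm_heatExtension_le_of_bound`), the Duhamel integrand is
bounded (Koch–Tataru (14): `exists_norm_oseenKernel_le`, `ChaeWolf.norm_integral_oseenKernel_le`) by
`K M₀ (t−σ)^{−1/2} (2ε)²/r²` on the KNOWN stretch `σ ≤ a` and by `K M₀ (t−σ)^{−1/2} C²/r²` on the short UNKNOWN
stretch `σ ∈ (a, t)` (a-priori Type-I bound) — one integrable majorant with an indicator, no integrability of the
Duhamel integrand needed (`norm_integral_le_of_norm_le`).  Hence
`r‖U(t,x)‖ ≤ ε + 16 K M₀ ε² + 2 K M₀ C² √(t−a)/r ≤ ε + ε/2 + ε/2`, the last term because `t − a ≤ δ|a|`,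
`−t ≥ |a|/2` and `δ ≤ ε²/(32 K²M₀²C⁴ + 1)`.  Induction along `aⱼ = −T(1−δ)ʲ → 0⁻` exhausts `[−T, 0)`; no continuity
of `t ↦ sup_x √(−t)‖U(t,x)‖` is used.

HONEST LABEL: ONE support stub (M) of a files-only line; it closes no cell, no crux and no route item; the research
residue `CellDefectiveReturnLeaf`, ⟨19708⟩ / ⟨20428⟩ and NS regularity stay OPEN — no summit statement is proved here.
-/

noncomputable section

-- the summit and its single sub-problem share the name (CONVENTIONS §1), as in every Theorems file
set_option linter.dupNamespace false

namespace Summit.NavierStokesRegularity.NavierStokesRegularity.Theorems.PoloidalWindowDoorPoloidalWindowRigidityUniformReturnWindowGap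

open Set Function Filter MeasureTheory
open Literature.Analysis Literature.Analysis.FluidPDE

/-! ## The time weight on a general stretch `(a, t)` -/

/-- For `a ≤ t` the weight `σ ↦ (t − σ)^{−1/2}` is integrable on `(a, t)`. -/
theorem integrableOn_rpow_sub_Ioo {a t : ℝ} (hat : a ≤ t) :
    IntegrableOn (fun σ : ℝ => (t - σ) ^ (-(1 / 2 : ℝ))) (Ioo a t) := by
  have hII : IntervalIntegrable (fun x : ℝ => x ^ (-(1 / 2 : ℝ))) volume (t - a) 0 :=
    intervalIntegral.intervalIntegrable_rpow' (by norm_num)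
  have hc := hII.comp_sub_left t
  have e1 : t - (t - a) = a := by ring
  have e2 : t - 0 = t := by ring
  rw [e1, e2] at hc
  exact (intervalIntegrable_iff_integrableOn_Ioo_of_le hat).1 hc

/-- `∫_{(a, t)} (t − σ)^{−1/2} dσ = 2 √(t − a)` for `a ≤ t`. -/
theorem integral_rpow_sub_Ioo {a t : ℝ} (hat : a ≤ t) :
    ∫ σ in Ioo a t, (t - σ) ^ (-(1 / 2 : ℝ)) = 2 * Real.sqrt (t - a) := by
  rw [← integral_Ioc_eq_integral_Ioo, ← intervalIntegral.integral_of_le hat,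
    intervalIntegral.integral_comp_sub_left (fun x : ℝ => x ^ (-(1 / 2 : ℝ))) t]
  have e1 : t - t = 0 := by ring
  rw [e1, integral_rpow (Or.inl (by norm_num))]
  have e3 : (-(1 / 2 : ℝ)) + 1 = 1 / 2 := by norm_num
  rw [e3, Real.zero_rpow (by norm_num), sub_zero, Real.sqrt_eq_rpow]
  ring

/-- `(a, ∞) ∩ (b, t) = (a, t)` when `b ≤ a`. -/
theorem Ioi_inter_Ioo_of_le {a b t : ℝ} (hba : b ≤ a) : Ioi a ∩ Ioo b t = Ioo a t := by
  ext σ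
  simp only [mem_inter_iff, mem_Ioi, mem_Ioo]
  constructor
  · rintro ⟨h1, -, h3⟩
    exact ⟨h1, h3⟩
  · rintro ⟨h1, h3⟩
    exact ⟨h1, lt_of_le_of_lt hba h1, h3⟩

/-! ## One forward step -/

/-- **One forward step of the windowed gap.**  `K₁` is a constant for which the spatial Oseen integral obeys
`‖∫ K(τ, x−y)[f y, f y] dy‖ ≤ K₁ τ^{−1/2} A²` whenever `‖f‖ ≤ A`; scale-covariant `2ε`-smallness is known on `[−4T, a]`,
`−T ≤ a < t < 0`, `4t ≤ a`, `32 K₁ ε ≤ 1` and the short stretch satisfies `16 K₁² C⁴ (t − a) ≤ ε² (−t)`; then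
`√(−t)‖U(t, x)‖ ≤ 2ε`. -/
theorem step {C : ℝ} {U : ℝ → EuclideanSpace ℝ (Fin 3) → EuclideanSpace ℝ (Fin 3)} (hU : IsTypeIAncientMild C U)
    {K₁ : ℝ} (hK₁ : 0 ≤ K₁)
    (hker : ∀ {τ : ℝ}, 0 < τ → ∀ (x : EuclideanSpace ℝ (Fin 3))
      {f : EuclideanSpace ℝ (Fin 3) → EuclideanSpace ℝ (Fin 3)} {A : ℝ}, (∀ y, ‖f y‖ ≤ A) →
      ‖∫ y, oseenKernel τ (x - y) (f y) (f y)‖ ≤ K₁ * τ ^ (-(1 / 2 : ℝ)) * A ^ 2)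
    {ε T a t : ℝ} (hε : 0 < ε) (hεK : 32 * K₁ * ε ≤ 1) (hTa : -T ≤ a) (hat : a < t)
    (h4t : 4 * t ≤ a) (ht : t < 0) (hshort : 16 * K₁ ^ 2 * C ^ 4 * (t - a) ≤ ε ^ 2 * (-t))
    (hIH : ∀ s : ℝ, -(4 * T) ≤ s → s ≤ a → ∀ x, Real.sqrt (-s) * ‖U s x‖ ≤ 2 * ε)
    (x : EuclideanSpace ℝ (Fin 3)) : Real.sqrt (-t) * ‖U t x‖ ≤ 2 * ε := by
  set r : ℝ := Real.sqrt (-t) with hr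
  have hr0 : 0 < r := Real.sqrt_pos.2 (by linarith)
  have hr2 : r ^ 2 = -t := Real.sq_sqrt (by linarith)
  have h4T : -(4 * T) ≤ 4 * t := by linarith
  -- pointwise bounds: `‖U s y‖ ≤ 2ε/√(-s)` on the known region, `≤ C/√(-s)` everywhere
  have hknown : ∀ s : ℝ, -(4 * T) ≤ s → s ≤ a → ∀ y, ‖U s y‖ ≤ 2 * ε / Real.sqrt (-s) := by
    intro s hs1 hs2 y
    have hs0 : s < 0 := lt_of_le_of_lt hs2 (hat.trans ht)
    have hss : 0 < Real.sqrt (-s) := Real.sqrt_pos.2 (by linarith)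
    rw [le_div_iff₀ hss, mul_comm]
    exact hIH s hs1 hs2 y
  -- the Oseen identity of the class between `4t` and `t`
  have hmild : U t x =
      Literature.Analysis.UnboundedOperators.heatExtension (U (4 * t)) (t - 4 * t) x -
        oseenDuhamel 1 (4 * t) U U t x :=
    hU.mild_eq_heatExtension (by linarith) ht x
  -- the caloric term: `≤ ε / r`
  have hheat :
      ‖Literature.Analysis.UnboundedOperators.heatExtension (U (4 * t)) (t - 4 * t) x‖ ≤ ε / r := by
    have hb : ∀ z, ‖U (4 * t) z‖ ≤ ε / r := by
      intro z
      have h1 := hknown (4 * t) h4T h4t z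
      rw [ChaeWolf.sqrt_neg_four_mul, ← hr] at h1
      have e : 2 * ε / (2 * r) = ε / r := by field_simp
      rwa [e] at h1
    exact Literature.Analysis.UnboundedOperators.norm_heatExtension_le_of_bound hb (by linarith) x
  -- the Duhamel term: one integrable majorant with an indicator on the unknown stretch `(a, t)`
  set g : ℝ → ℝ := fun σ =>
    K₁ * (4 * ε ^ 2 / r ^ 2) * (t - σ) ^ (-(1 / 2 : ℝ)) +
      (Ioi a).indicator (fun σ => K₁ * (C ^ 2 / r ^ 2) * (t - σ) ^ (-(1 / 2 : ℝ))) σ with hg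
  have hw_int : IntegrableOn (fun σ : ℝ => (t - σ) ^ (-(1 / 2 : ℝ))) (Ioo (4 * t) t) :=
    ChaeWolf.integrableOn_rpow_sub ht
  have hg1_int : IntegrableOn (fun σ : ℝ => K₁ * (4 * ε ^ 2 / r ^ 2) * (t - σ) ^ (-(1 / 2 : ℝ)))
      (Ioo (4 * t) t) := hw_int.const_mul _
  have hg2_int : IntegrableOn
      (fun σ : ℝ => (Ioi a).indicator (fun σ => K₁ * (C ^ 2 / r ^ 2) * (t - σ) ^ (-(1 / 2 : ℝ))) σ)
      (Ioo (4 * t) t) := (hw_int.const_mul _).indicator measurableSet_Ioi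
  have hG : IntegrableOn g (Ioo (4 * t) t) := hg1_int.add hg2_int
  have hduh : ‖oseenDuhamel 1 (4 * t) U U t x‖ ≤
      16 * K₁ * ε ^ 2 / r + 2 * K₁ * C ^ 2 * Real.sqrt (t - a) / r ^ 2 := by
    rw [oseenDuhamel_apply]
    have hpt : ∀ᵐ σ ∂(volume.restrict (Ioo (4 * t) t)),
        ‖∫ y, oseenKernel (1 * (t - σ)) (x - y) (U σ y) (U σ y)‖ ≤ g σ := by
      refine ae_restrict_of_forall_mem measurableSet_Ioo fun σ hσ => ?_
      have hσ0 : σ < 0 := hσ.2.trans ht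
      have hτ : 0 < t - σ := by linarith [hσ.2]
      have hw0 : 0 ≤ (t - σ) ^ (-(1 / 2 : ℝ)) := Real.rpow_nonneg hτ.le _
      have hσr : r ^ 2 ≤ -σ := by rw [hr2]; linarith [hσ.2]
      rw [one_mul]
      rcases le_or_gt σ a with hσa | hσa
      · -- known stretch: bound `2ε/√(-σ)`
        have h1 := hker hτ x (hknown σ (le_of_lt (lt_of_le_of_lt h4T hσ.1)) hσa)
        refine h1.trans ?_
        have hsq : (2 * ε / Real.sqrt (-σ)) ^ 2 = 4 * ε ^ 2 / (-σ) := by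
          rw [div_pow, Real.sq_sqrt (by linarith)]; ring
        rw [hsq]
        have hfrac : 4 * ε ^ 2 / (-σ) ≤ 4 * ε ^ 2 / r ^ 2 :=
          div_le_div_of_nonneg_left (by positivity) (by positivity) hσr
        have hind : 0 ≤ (Ioi a).indicator
            (fun σ => K₁ * (C ^ 2 / r ^ 2) * (t - σ) ^ (-(1 / 2 : ℝ))) σ := by
          rw [indicator_of_notMem (notMem_Ioi.2 hσa)]
        calc K₁ * (t - σ) ^ (-(1 / 2 : ℝ)) * (4 * ε ^ 2 / -σ)
            ≤ K₁ * (t - σ) ^ (-(1 / 2 : ℝ)) * (4 * ε ^ 2 / r ^ 2) := by gcongr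
          _ = K₁ * (4 * ε ^ 2 / r ^ 2) * (t - σ) ^ (-(1 / 2 : ℝ)) := by ring
          _ ≤ g σ := le_add_of_nonneg_right hind
      · -- unknown short stretch: a-priori Type-I bound `C/√(-σ)`
        have h1 := hker hτ x (fun y => hU.norm_le hσ0 y)
        refine h1.trans ?_
        have hsq : (C / Real.sqrt (-σ)) ^ 2 = C ^ 2 / (-σ) := by
          rw [div_pow, Real.sq_sqrt (by linarith)]
        rw [hsq]
        have hfrac : C ^ 2 / (-σ) ≤ C ^ 2 / r ^ 2 :=
          div_le_div_of_nonneg_left (sq_nonneg C) (by positivity) hσr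
        have hfirst : 0 ≤ K₁ * (4 * ε ^ 2 / r ^ 2) * (t - σ) ^ (-(1 / 2 : ℝ)) := by positivity
        have hind : (Ioi a).indicator
            (fun σ => K₁ * (C ^ 2 / r ^ 2) * (t - σ) ^ (-(1 / 2 : ℝ))) σ =
              K₁ * (C ^ 2 / r ^ 2) * (t - σ) ^ (-(1 / 2 : ℝ)) :=
          indicator_of_mem (mem_Ioi.2 hσa) _
        calc K₁ * (t - σ) ^ (-(1 / 2 : ℝ)) * (C ^ 2 / -σ)
            ≤ K₁ * (t - σ) ^ (-(1 / 2 : ℝ)) * (C ^ 2 / r ^ 2) := by gcongr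
          _ = K₁ * (C ^ 2 / r ^ 2) * (t - σ) ^ (-(1 / 2 : ℝ)) := by ring
          _ ≤ g σ := by rw [hg]; dsimp only; rw [hind]; exact le_add_of_nonneg_left hfirst
    refine (norm_integral_le_of_norm_le hG hpt).trans ?_
    -- evaluate the majorant
    have hI1 : ∫ σ in Ioo (4 * t) t, K₁ * (4 * ε ^ 2 / r ^ 2) * (t - σ) ^ (-(1 / 2 : ℝ)) =
        K₁ * (4 * ε ^ 2 / r ^ 2) * (2 * Real.sqrt (-(3 * t))) := by
      rw [MeasureTheory.integral_const_mul, ChaeWolf.integral_rpow_sub ht]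
    have hI2 : ∫ σ in Ioo (4 * t) t,
        (Ioi a).indicator (fun σ => K₁ * (C ^ 2 / r ^ 2) * (t - σ) ^ (-(1 / 2 : ℝ))) σ =
          K₁ * (C ^ 2 / r ^ 2) * (2 * Real.sqrt (t - a)) := by
      rw [integral_indicator measurableSet_Ioi, Measure.restrict_restrict measurableSet_Ioi,
        Ioi_inter_Ioo_of_le h4t, MeasureTheory.integral_const_mul, integral_rpow_sub_Ioo hat.le]
    have hsum : ∫ σ in Ioo (4 * t) t, g σ =
        K₁ * (4 * ε ^ 2 / r ^ 2) * (2 * Real.sqrt (-(3 * t))) +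
          K₁ * (C ^ 2 / r ^ 2) * (2 * Real.sqrt (t - a)) := by
      rw [hg]
      dsimp only
      rw [integral_add hg1_int hg2_int, hI1, hI2]
    rw [hsum]
    have h3 := ChaeWolf.sqrt_neg_three_mul_le t ht
    rw [← hr] at h3
    have hrr : r ^ 2 = r * r := sq r
    have hsa : 0 ≤ Real.sqrt (t - a) := Real.sqrt_nonneg _
    calc K₁ * (4 * ε ^ 2 / r ^ 2) * (2 * Real.sqrt (-(3 * t))) +
          K₁ * (C ^ 2 / r ^ 2) * (2 * Real.sqrt (t - a))
        ≤ K₁ * (4 * ε ^ 2 / r ^ 2) * (2 * (2 * r)) + K₁ * (C ^ 2 / r ^ 2) * (2 * Real.sqrt (t - a)) := by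
          gcongr
      _ = 16 * K₁ * ε ^ 2 / r + 2 * K₁ * C ^ 2 * Real.sqrt (t - a) / r ^ 2 := by
          rw [hrr]
          field_simp
          ring
  -- the short stretch: `2 K₁ C² √(t - a) ≤ (ε/2) r`
  have hshort' : 4 * K₁ * C ^ 2 * Real.sqrt (t - a) ≤ ε * r := by
    have h1 : Real.sqrt (16 * K₁ ^ 2 * C ^ 4 * (t - a)) ≤ Real.sqrt (ε ^ 2 * (-t)) :=
      Real.sqrt_le_sqrt hshort
    have e1 : Real.sqrt (16 * K₁ ^ 2 * C ^ 4 * (t - a)) = 4 * K₁ * C ^ 2 * Real.sqrt (t - a) := by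
      rw [show 16 * K₁ ^ 2 * C ^ 4 * (t - a) = (4 * K₁ * C ^ 2) ^ 2 * (t - a) by ring,
        Real.sqrt_mul' _ (by linarith), Real.sqrt_sq (by positivity)]
    have e2 : Real.sqrt (ε ^ 2 * (-t)) = ε * r := by
      rw [Real.sqrt_mul' _ (by linarith), Real.sqrt_sq hε.le, hr]
    rwa [e1, e2] at h1
  -- the quadratic term: `16 K₁ ε² ≤ ε/2`
  have hquad : 16 * K₁ * ε ^ 2 ≤ ε / 2 := by
    have : 16 * K₁ * ε ^ 2 = (32 * K₁ * ε) * ε / 2 := by ring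
    rw [this]
    have h2 : (32 * K₁ * ε) * ε ≤ 1 * ε := mul_le_mul_of_nonneg_right hεK hε.le
    linarith
  -- assemble
  have hnorm : ‖U t x‖ ≤ ε / r + (16 * K₁ * ε ^ 2 / r + 2 * K₁ * C ^ 2 * Real.sqrt (t - a) / r ^ 2) := by
    rw [hmild]
    exact (norm_sub_le _ _).trans (add_le_add hheat hduh)
  have hfin : r * ‖U t x‖ ≤ ε + 16 * K₁ * ε ^ 2 + 2 * K₁ * C ^ 2 * Real.sqrt (t - a) / r := by
    calc r * ‖U t x‖
        ≤ r * (ε / r + (16 * K₁ * ε ^ 2 / r + 2 * K₁ * C ^ 2 * Real.sqrt (t - a) / r ^ 2)) := by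
          gcongr
      _ = ε + 16 * K₁ * ε ^ 2 + 2 * K₁ * C ^ 2 * Real.sqrt (t - a) / r := by
          field_simp
          ring
  have hlast : 2 * K₁ * C ^ 2 * Real.sqrt (t - a) / r ≤ ε / 2 := by
    rw [div_le_iff₀ hr0]
    linarith
  linarith

/-! ## The stub -/

/-- **U1b `WindowGap` (VERBATIM, the Cruxes-local def unfolded): the windowed gap.**  For every `C` there is `ε₁ > 0`
such that for every `U ∈ A_C`, scale-covariant smallness `√(−t)‖U‖ ≤ ε ≤ ε₁` on one window `[−4T, −T]`, `T > 0`,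
propagates to `√(−t)‖U‖ ≤ 2ε` on `[−4T, 0)` (module docstring for the proof). -/
theorem windowGap :
    ∀ C : ℝ, ∃ ε₁ : ℝ, 0 < ε₁ ∧ ∀ (U : ℝ → EuclideanSpace ℝ (Fin 3) → EuclideanSpace ℝ (Fin 3)),
      IsTypeIAncientMild C U →
      ∀ (T ε : ℝ), 0 < T → 0 < ε → ε ≤ ε₁ →
        (∀ t ∈ Set.Icc (-(4 * T)) (-T), ∀ x, Real.sqrt (-t) * ‖U t x‖ ≤ ε) →
        ∀ t : ℝ, -(4 * T) ≤ t → t < 0 → ∀ x, Real.sqrt (-t) * ‖U t x‖ ≤ 2 * ε := by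
  intro C
  -- Koch–Tataru's kernel constant in dimension three and the spatial moment `M₀`
  obtain ⟨K, hK, hKb⟩ := exists_norm_oseenKernel_le (E := EuclideanSpace ℝ (Fin 3))
  set M₀ : ℝ := ∫ w : EuclideanSpace ℝ (Fin 3), (1 + ‖w‖ ^ 2) ^ (-(2 : ℝ)) with hM₀
  have hM₀0 : 0 ≤ M₀ := integral_nonneg fun w => Real.rpow_nonneg (by positivity) _
  set K₁ : ℝ := K * M₀ with hK₁
  have hK₁0 : 0 ≤ K₁ := by positivity
  set ε₁ : ℝ := 1 / (32 * K₁ + 1) with hε₁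
  have hε₁0 : 0 < ε₁ := by positivity
  refine ⟨ε₁, hε₁0, ?_⟩
  intro U hU T ε hT hε hεle hwin t ht4 ht0 x
  have finrank_R3_real : ((Module.finrank ℝ (EuclideanSpace ℝ (Fin 3)) : ℕ) : ℝ) = 3 := by simp
  have hK' : ∀ {τ : ℝ}, 0 < τ → ∀ z a b : EuclideanSpace ℝ (Fin 3),
      ‖oseenKernel τ z a b‖ ≤ K * (τ + ‖z‖ ^ 2) ^ (-(2 : ℝ)) * ‖a‖ * ‖b‖ := by
    intro τ hτ z a b
    have h := hKb hτ z a b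
    rw [finrank_R3_real, show (-(((3 : ℝ) + 1) / 2)) = -(2 : ℝ) by norm_num] at h
    exact h
  have hker : ∀ {τ : ℝ}, 0 < τ → ∀ (x : EuclideanSpace ℝ (Fin 3))
      {f : EuclideanSpace ℝ (Fin 3) → EuclideanSpace ℝ (Fin 3)} {A : ℝ}, (∀ y, ‖f y‖ ≤ A) →
      ‖∫ y, oseenKernel τ (x - y) (f y) (f y)‖ ≤ K₁ * τ ^ (-(1 / 2 : ℝ)) * A ^ 2 := by
    intro τ hτ x f A hA
    have h := ChaeWolf.norm_integral_oseenKernel_le hK' hK.le hτ x hA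
    rw [← hM₀] at h
    calc ‖∫ y, oseenKernel τ (x - y) (f y) (f y)‖ ≤ K * M₀ * τ ^ (-(1 / 2 : ℝ)) * A ^ 2 := h
      _ = K₁ * τ ^ (-(1 / 2 : ℝ)) * A ^ 2 := by rw [hK₁]
  have hεK : 32 * K₁ * ε ≤ 1 := by
    have h1 : 32 * K₁ * ε ≤ 32 * K₁ * ε₁ := by gcongr
    have h2 : 32 * K₁ * ε₁ ≤ 1 := by
      rw [hε₁, mul_one_div, div_le_one (by positivity)]
      linarith
    exact h1.trans h2
  -- the step ratio `q = 1 - δ`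
  set δ : ℝ := min (1 / 2) (ε ^ 2 / (32 * K₁ ^ 2 * C ^ 4 + 1)) with hδ
  have hδpos : 0 < δ := lt_min (by norm_num) (by positivity)
  have hδhalf : δ ≤ 1 / 2 := min_le_left _ _
  have hδC : 32 * K₁ ^ 2 * C ^ 4 * δ ≤ ε ^ 2 := by
    have h1 : δ ≤ ε ^ 2 / (32 * K₁ ^ 2 * C ^ 4 + 1) := min_le_right _ _
    have h2 : 32 * K₁ ^ 2 * C ^ 4 * δ ≤ (32 * K₁ ^ 2 * C ^ 4 + 1) * δ := by
      gcongr; linarith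
    have h3 : (32 * K₁ ^ 2 * C ^ 4 + 1) * δ ≤ ε ^ 2 := by
      rw [← le_div_iff₀' (by positivity)]
      exact h1
    exact h2.trans h3
  set q : ℝ := 1 - δ with hq
  have hq0 : 0 < q := by rw [hq]; linarith
  have hq1 : q < 1 := by rw [hq]; linarith
  have hqhalf : 1 / 2 ≤ q := by rw [hq]; linarith
  -- the geometric ladder `a j = -T q^j`
  set a : ℕ → ℝ := fun j => -T * q ^ j with ha
  have ha_neg : ∀ j, a j < 0 := fun j => by
    have : 0 < T * q ^ j := mul_pos hT (pow_pos hq0 j)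
    simp only [ha]; linarith
  have ha_ge : ∀ j, -T ≤ a j := fun j => by
    have h1 : q ^ j ≤ 1 := pow_le_one₀ hq0.le hq1.le
    have : T * q ^ j ≤ T * 1 := mul_le_mul_of_nonneg_left h1 hT.le
    simp only [ha]; linarith
  have ha_succ : ∀ j, a (j + 1) = q * a j := fun j => by
    simp only [ha, pow_succ]; ring
  -- induction along the ladder
  have hclaim : ∀ j : ℕ, ∀ s : ℝ, -(4 * T) ≤ s → s ≤ a j → ∀ y, Real.sqrt (-s) * ‖U s y‖ ≤ 2 * ε := by
    intro j
    induction j with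
    | zero =>
      intro s hs1 hs2 y
      have hs2' : s ≤ -T := by simpa [ha] using hs2
      have h := hwin s ⟨hs1, hs2'⟩ y
      linarith
    | succ j ih =>
      intro s hs1 hs2 y
      rcases le_or_gt s (a j) with hsa | hsa
      · exact ih s hs1 hsa y
      · -- `s ∈ (a j, q · a j]`: one forward step
        rw [ha_succ] at hs2
        have haj := ha_neg j
        have hs0 : s < 0 := by nlinarith
        have h4s : 4 * s ≤ a j := by nlinarith
        have hshort : 16 * K₁ ^ 2 * C ^ 4 * (s - a j) ≤ ε ^ 2 * (-s) := by
          have h1 : s - a j ≤ δ * (-(a j)) := by rw [hq] at hs2; nlinarith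
          have h2 : -(a j) / 2 ≤ -s := by nlinarith
          have h3 : 16 * K₁ ^ 2 * C ^ 4 * (s - a j) ≤ 16 * K₁ ^ 2 * C ^ 4 * (δ * (-(a j))) :=
            mul_le_mul_of_nonneg_left h1 (by positivity)
          have h4 : 16 * K₁ ^ 2 * C ^ 4 * (δ * (-(a j))) = (32 * K₁ ^ 2 * C ^ 4 * δ) * (-(a j) / 2) := by
            ring
          have h5 : (32 * K₁ ^ 2 * C ^ 4 * δ) * (-(a j) / 2) ≤ ε ^ 2 * (-(a j) / 2) :=
            mul_le_mul_of_nonneg_right hδC (by linarith)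
          have h6 : ε ^ 2 * (-(a j) / 2) ≤ ε ^ 2 * (-s) := mul_le_mul_of_nonneg_left h2 (by positivity)
          linarith
        exact step hU hK₁0 hker hε hεK (ha_ge j) hsa h4s hs0 hshort ih y
  -- every `t ∈ [-4T, 0)` lies below some rung `a j`
  obtain ⟨j, hj⟩ := exists_pow_lt_of_lt_one (div_pos (neg_pos.2 ht0) hT) hq1
  have htj : t ≤ a j := by
    have h1 : T * q ^ j < T * (-t / T) := mul_lt_mul_of_pos_left hj hT
    have h2 : T * (-t / T) = -t := by field_simp
    simp only [ha]
    linarith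
  exact hclaim j t ht4 htj x

end Summit.NavierStokesRegularity.NavierStokesRegularity.Theorems.PoloidalWindowDoorPoloidalWindowRigidityUniformReturnWindowGap

end
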